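import Mathlib
import Literature.NumberTheory.Transcendental.AssociatorsProofs
import Literature.NumberTheory.Transcendental.AssociatorsRegularisation
import HarnessLib

/-!
# Associators III: the substitution calculus of group-like series [Furusho2010, §2]

Second proofs file towards [Furusho2010, Thm 1] (`furusho_pentagon_hexagon`), continuing
`AssociatorsProofs.lean`. It supplies the algebra of the weight-truncated substitution
`NCSeries.evalTrunc` that every later step of the printed proof uses ("for any `k`-algebra
homomorphism `ι : U𝔉₂ → S` the image `ι(φ)` is denoted `φ(ι(X), ι(Y))`", [Furusho2010, p. 546]):

1. `NCSeries.evalTrunc_mul`, `evalTrunc_pow`, `evalTrunc_smul`, `evalTrunc_finset_sum`,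
   `evalTrunc_congr`: on an `(N+1)`-nilpotent substitution, `φ ↦ φ(v)` truncated at weight `N` is an
   algebra morphism (`NCSeries.evalAlgHom`), which kills the truncation ideal.
2. `NCSeries.deshuffle w` — the `2^{|w|}` splittings of a word into two complementary subwords —
   and the **transposition** `NCSeries.count_deshuffle`: `(u, u')` occurs in `deshuffle w` as often
   as `w` occurs in `u ш u'` (the coproduct `Δ` is the transpose of the shuffle product; Racinet
   2002, §2 / Reutenauer 1993, §1.4), with the resulting summation formula
   `NCSeries.sum_smul_deshuffle_eq`.
3. The **word binomial formula** `NCSeries.prod_map_bsub_add`: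
   `w(a + c, b + d) = Σ_{(u,u') ∈ deshuffle w} u(a,b) u'(c,d)` when `c, d` commute with `a, b`.
4. The **central-shift invariance** of commutator-group-like series
   (`NCSeries.IsGroupLike.evalTrunc_bsub_add_left/right`): `φ(A + C, B) = φ(A, B + C) = φ(A, B)`
   whenever `C` commutes with `A` and `B` — "N.B. If `φ` is commutator group-like,
   `φ(A + C, B) = φ(A, B + C) = φ(A, B)` with `[A, C] = [B, C] = 0`" [Furusho2010, p. 551, proof
   of Lemma 5]; it is the step used in Lemma 5 and in Lemma 7 (hexagons ⇔ 2- and 3-cycle).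

No named facts are introduced.

## References

* H. Furusho, *Pentagon and hexagon equations*, Ann. of Math. 171 (2010), 545–556, §2, proof of
  Lemma 5 (p. 551). [Furusho2010]
* G. Racinet, *Doubles mélanges des polylogarithmes multiples aux racines de l'unité*, Publ.
  Math. IHÉS 95 (2002), §2. [Racinet2002]
-/

noncomputable section

open scoped BigOperators

namespace Literature.NumberTheory.Transcendental

universe u v

namespace NCSeries

variable {α : Type u} {R : Type v}

/-! ## 1. `evalTrunc` is an algebra morphism on nilpotent substitutions -/

section EvalHom

variable [CommSemiring R] {A : Type*} [Semiring A] [Algebra R A] [Fintype α] [DecidableEq α]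

/-- `evalTrunc` only reads coefficients of weight `≤ N`. [folklore] -/
theorem evalTrunc_congr (N : ℕ) (v : α → A) {φ ψ : NCSeries α R}
    (h : ∀ w : List α, w.length ≤ N → φ w = ψ w) : evalTrunc N v φ = evalTrunc N v ψ := by
  rw [evalTrunc_eq_sum_wordsLE, evalTrunc_eq_sum_wordsLE]
  exact Finset.sum_congr rfl fun w hw => by rw [h w (mem_wordsLE.mp hw)]

/-- `evalTrunc` is `R`-linear: scalars. [folklore] -/
theorem evalTrunc_smul (N : ℕ) (v : α → A) (r : R) (φ : NCSeries α R) :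
    evalTrunc N v (r • φ) = r • evalTrunc N v φ := by
  simp only [evalTrunc_eq_sum_wordsLE, smul_apply, smul_eq_mul, mul_smul, Finset.smul_sum]

/-- `evalTrunc` is additive over finite sums. [folklore] -/
theorem evalTrunc_finset_sum {ι : Type*} (N : ℕ) (v : α → A) (s : Finset ι)
    (g : ι → NCSeries α R) : evalTrunc N v (∑ i ∈ s, g i) = ∑ i ∈ s, evalTrunc N v (g i) := by
  classical
  induction s using Finset.induction_on with
  | empty => simp [evalTrunc_eq_sum_wordsLE]
  | insert i s hi ih => rw [Finset.sum_insert hi, Finset.sum_insert hi, evalTrunc_add, ih]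

/-- **`evalTrunc` is multiplicative on `(N+1)`-nilpotent substitutions**: if every product of more
than `N` values of `v` vanishes, then `(φ ψ)(v) = φ(v) ψ(v)` in weight truncation `N`.
[folklore] -/
theorem evalTrunc_mul (N : ℕ) (v : α → A) (hv : ∀ w : List α, N < w.length → (w.map v).prod = 0)
    (φ ψ : NCSeries α R) : evalTrunc N v (φ * ψ) = evalTrunc N v φ * evalTrunc N v ψ := by
  rw [evalTrunc_eq_sum_wordsLE, evalTrunc_eq_sum_wordsLE, evalTrunc_eq_sum_wordsLE,
    Finset.sum_mul_sum, ← Finset.sum_product']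
  rw [← Finset.sum_filter_add_sum_filter_not (wordsLE α N ×ˢ wordsLE α N)
    (fun p : List α × List α => p.1.length + p.2.length ≤ N)]
  rw [Finset.sum_eq_zero (s := (wordsLE α N ×ˢ wordsLE α N).filter
      (fun p : List α × List α => ¬ (p.1.length + p.2.length ≤ N))) ?_, add_zero]
  · have hset : (wordsLE α N ×ˢ wordsLE α N).filter
        (fun p : List α × List α => p.1.length + p.2.length ≤ N) =
          (wordsLE α N).biUnion splits := by
      ext ⟨u, u'⟩
      simp only [Finset.mem_filter, Finset.mem_product, mem_wordsLE, Finset.mem_biUnion,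
        mem_splits]
      constructor
      · rintro ⟨-, h⟩
        exact ⟨u ++ u', by simpa using h, rfl⟩
      · rintro ⟨w, hw, rfl⟩
        simp only [List.length_append] at hw
        omega
    rw [hset, Finset.sum_biUnion]
    · refine Finset.sum_congr rfl fun w _ => ?_
      rw [mul_apply, Finset.sum_smul]
      refine Finset.sum_congr rfl fun p hp => ?_
      rw [mem_splits] at hp
      rw [← hp, List.map_append, List.prod_append, smul_mul_smul_comm]
    · intro w _ w' _ hne
      rw [Function.onFun, Finset.disjoint_left]
      intro p hp hp'
      rw [mem_splits] at hp hp'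
      exact hne (hp.symm.trans hp')
  · rintro ⟨u, u'⟩ hp
    simp only [Finset.mem_filter, Finset.mem_product, mem_wordsLE] at hp
    dsimp only
    rw [smul_mul_smul_comm, ← List.prod_append, ← List.map_append, hv _ ?_, smul_zero]
    simp only [List.length_append]
    omega

/-- Powers: `(φ^m)(v) = φ(v)^m` on nilpotent substitutions. [folklore] -/
theorem evalTrunc_pow (N : ℕ) (v : α → A) (hv : ∀ w : List α, N < w.length → (w.map v).prod = 0)
    (φ : NCSeries α R) : ∀ m : ℕ, evalTrunc N v (φ ^ m) = evalTrunc N v φ ^ m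
  | 0 => by rw [pow_zero, pow_zero]; exact evalTrunc_one N v
  | m + 1 => by rw [pow_succ, pow_succ, evalTrunc_mul N v hv, evalTrunc_pow N v hv φ m]

/-- A letter evaluates to its value (for `N ≥ 1`; for `N = 0` both sides vanish by nilpotency).
[folklore] -/
theorem evalTrunc_letter (N : ℕ) (v : α → A) (hv : ∀ w : List α, N < w.length → (w.map v).prod = 0)
    (a : α) : evalTrunc N v (letter a : NCSeries α R) = v a := by
  rw [evalTrunc_eq_sum_wordsLE]
  rcases Nat.eq_zero_or_pos N with hN | hN
  · subst hN
    have h1 : v a = 0 := by simpa using hv [a] (by simp)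
    rw [h1]
    refine Finset.sum_eq_zero fun w hw => ?_
    rw [mem_wordsLE, Nat.le_zero, List.length_eq_zero_iff] at hw
    subst hw
    simp
  · rw [Finset.sum_eq_single_of_mem [a] (by rw [mem_wordsLE]; exact hN) ?_]
    · simp
    · intro w _ hw
      rw [letter_apply, if_neg hw, zero_smul]

variable (N : ℕ) (v : α → A)

/-- **The evaluation morphism** `φ ↦ φ(v)` truncated at weight `N`, an `R`-algebra morphism
`R⟨⟨α⟩⟩ → A` for every `(N+1)`-nilpotent substitution `v` (Furusho's `φ ↦ φ(ι(X₀), ι(X₁))`).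
[cite: Furusho2010, §0 (p. 546)] -/
def evalAlgHom (hv : ∀ w : List α, N < w.length → (w.map v).prod = 0) : NCSeries α R →ₐ[R] A where
  toFun := evalTrunc N v
  map_one' := evalTrunc_one N v
  map_mul' := evalTrunc_mul N v hv
  map_zero' := by simpa using evalTrunc_C N v (0 : R)
  map_add' := evalTrunc_add N v
  commutes' r := by rw [algebraMap_apply, evalTrunc_C]

/-- `evalAlgHom N v hv φ = evalTrunc N v φ`. [folklore] -/
@[simp] theorem evalAlgHom_apply (hv : ∀ w : List α, N < w.length → (w.map v).prod = 0)
    (φ : NCSeries α R) : evalAlgHom N v hv φ = evalTrunc N v φ := rfl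

/-- The evaluation morphism kills the truncation ideal. [folklore] -/
theorem evalTrunc_eq_zero_of_mem_truncIdeal {φ : NCSeries α R} (h : φ ∈ truncIdeal α R N) :
    evalTrunc N v φ = 0 := by
  rw [evalTrunc_congr N v (ψ := 0) (fun w hw => mem_truncIdeal.mp h w hw)]
  simpa using evalTrunc_C N v (0 : R)

end EvalHom

section EvalHomRing

variable [CommRing R] {A : Type*} [Ring A] [Algebra R A] [Fintype α] [DecidableEq α]
  (N : ℕ) (v : α → A) (hv : ∀ w : List α, N < w.length → (w.map v).prod = 0)

/-- **The evaluation morphism on the truncated free algebra** `R⟨⟨α⟩⟩/(deg > N) → A`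
(universal property of `NCSeries α R ⧸ truncIdeal α R N` for nilpotent substitutions).
[folklore] -/
def evalQuotHom : (NCSeries α R ⧸ truncIdeal α R N) →ₐ[R] A :=
  Ideal.Quotient.liftₐ (truncIdeal α R N) (evalAlgHom N v hv)
    (fun _ hφ => evalTrunc_eq_zero_of_mem_truncIdeal N v hφ)

/-- `evalQuotHom [φ] = φ(v)`. [folklore] -/
@[simp] theorem evalQuotHom_mk (φ : NCSeries α R) :
    evalQuotHom N v hv (Ideal.Quotient.mk (truncIdeal α R N) φ) = evalTrunc N v φ := rfl

end EvalHomRing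

section EvalExp

variable [CommRing R] [Algebra ℚ R] {A : Type*} [Ring A] [Algebra R A] [Fintype α] [DecidableEq α]

omit [Fintype α] [DecidableEq α] in
/-- In weight `≤ N`, `exp S` is the finite sum `Σ_{m ≤ N} Sᵐ/m!` (`Sᵐ` has no word of length
`< m`: `NCSeries.pow_apply_eq_zero_of_length_lt` of `AssociatorsRegularisation.lean`). [folklore] -/
theorem exp_apply_eq_sum {S : NCSeries α R} (hS : S [] = 0) (N : ℕ) {w : List α}
    (hw : w.length ≤ N) :
    exp S w = (∑ m ∈ Finset.range (N + 1), algebraMap ℚ R (1 / (m.factorial : ℚ)) • S ^ m) w := by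
  rw [finset_sum_apply]
  unfold exp
  simp only [smul_apply, smul_eq_mul]
  refine Finset.sum_subset (fun m hm => ?_) (fun m _ hm => ?_)
  · simp only [Finset.mem_range] at hm ⊢; omega
  · rw [Finset.mem_range, not_lt] at hm
    rw [pow_apply_eq_zero_of_length_lt hS m w (by omega), mul_zero]

/-- **Exponentials are substituted into exponentials**: for `S` without constant term and an
`(N+1)`-nilpotent substitution, `(exp S)(v) = Σ_{m ≤ N} S(v)ᵐ/m!` (the truncated exponential,
e.g. `DrinfeldKohnoTrunc.expT`). [folklore] -/
theorem evalTrunc_exp (N : ℕ) (v : α → A) (hv : ∀ w : List α, N < w.length → (w.map v).prod = 0)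
    {S : NCSeries α R} (hS : S [] = 0) :
    evalTrunc N v (exp S) =
      ∑ m ∈ Finset.range (N + 1), algebraMap ℚ R (1 / (m.factorial : ℚ)) • evalTrunc N v S ^ m := by
  rw [evalTrunc_congr N v (fun w hw => exp_apply_eq_sum hS N hw), evalTrunc_finset_sum]
  refine Finset.sum_congr rfl fun m _ => ?_
  rw [evalTrunc_smul, evalTrunc_pow N v hv]

end EvalExp

/-! ## 2. Deshuffles and the transposition formula -/

section Deshuffle

/-- The **deshuffles** of a word `w`: all `2^{|w|}` ways of distributing its letters, in order,
over two complementary subwords `(u, u')`, listed with multiplicity (the terms of the coproduct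
`Δ(w) = Σ u ⊗ u'` of the letter-primitive bialgebra structure on `R⟨α⟩`). [cite: Racinet2002, §2] -/
def deshuffle : List α → List (List α × List α)
  | [] => [([], [])]
  | x :: w => (deshuffle w).map (fun p => (x :: p.1, p.2)) ++
      (deshuffle w).map (fun p => (p.1, x :: p.2))

/-- `deshuffle [] = [([], [])]`. [folklore] -/
@[simp] theorem deshuffle_nil : deshuffle ([] : List α) = [([], [])] := rfl

/-- The defining recursion of `deshuffle`. [folklore] -/
theorem deshuffle_cons (x : α) (w : List α) :
    deshuffle (x :: w) = (deshuffle w).map (fun p => (x :: p.1, p.2)) ++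
      (deshuffle w).map (fun p => (p.1, x :: p.2)) := rfl

/-- The two parts of a deshuffle have total length `|w|`. [folklore] -/
theorem length_add_length_of_mem_deshuffle :
    ∀ (w : List α) {p : List α × List α}, p ∈ deshuffle w → p.1.length + p.2.length = w.length
  | [], p, hp => by
    rw [deshuffle_nil, List.mem_singleton] at hp
    subst hp; rfl
  | x :: w, p, hp => by
    rw [deshuffle_cons, List.mem_append, List.mem_map, List.mem_map] at hp
    rcases hp with ⟨q, hq, rfl⟩ | ⟨q, hq, rfl⟩
    · have := length_add_length_of_mem_deshuffle w hq
      simp only [List.length_cons]; omega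
    · have := length_add_length_of_mem_deshuffle w hq
      simp only [List.length_cons]; omega

variable [DecidableEq α]

/-- Counting a pair with prescribed first letter of the first component. [folklore] -/
theorem count_map_consFst (x : α) (u u' : List α) (D : List (List α × List α)) :
    (D.map fun p => (x :: p.1, p.2)).count (u, u') =
      match u with
      | [] => 0
      | a :: u₁ => if a = x then D.count (u₁, u') else 0 := by
  induction D with
  | nil => cases u <;> simp
  | cons q D ih =>
    rw [List.map_cons, List.count_cons, ih]
    cases u with
    | nil =>
      have hne : ((x :: q.1, q.2) == (([] : List α), u')) = false := by
        rw [beq_eq_false_iff_ne]; simp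
      simp [hne]
    | cons a u₁ =>
      dsimp only
      by_cases hax : a = x
      · subst hax
        rw [if_pos rfl, if_pos rfl, List.count_cons]
        congr 1
        by_cases hq : q = (u₁, u')
        · subst hq; simp
        · have h1 : ((a :: q.1, q.2) == (a :: u₁, u')) = false := by
            rw [beq_eq_false_iff_ne]; intro h
            apply hq; cases q; simp only [Prod.mk.injEq, List.cons.injEq, true_and] at h
            exact Prod.ext h.1 h.2
          have h2 : (q == (u₁, u')) = false := beq_eq_false_iff_ne.mpr hq
          rw [h1, h2]
      · rw [if_neg hax, if_neg hax]
        have hne : ((x :: q.1, q.2) == (a :: u₁, u')) = false := by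
          rw [beq_eq_false_iff_ne]; intro h
          simp only [Prod.mk.injEq, List.cons.injEq] at h
          exact hax h.1.1.symm
        simp [hne]

/-- Counting a pair with prescribed first letter of the second component. [folklore] -/
theorem count_map_consSnd (x : α) (u u' : List α) (D : List (List α × List α)) :
    (D.map fun p => (p.1, x :: p.2)).count (u, u') =
      match u' with
      | [] => 0
      | b :: u₁' => if b = x then D.count (u, u₁') else 0 := by
  induction D with
  | nil => cases u' <;> simp
  | cons q D ih =>
    rw [List.map_cons, List.count_cons, ih]
    cases u' with
    | nil =>
      have hne : ((q.1, x :: q.2) == (u, ([] : List α))) = false := by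
        rw [beq_eq_false_iff_ne]; simp
      simp [hne]
    | cons b u₁' =>
      dsimp only
      by_cases hbx : b = x
      · subst hbx
        rw [if_pos rfl, if_pos rfl, List.count_cons]
        congr 1
        by_cases hq : q = (u, u₁')
        · subst hq; simp
        · have h1 : ((q.1, b :: q.2) == (u, b :: u₁')) = false := by
            rw [beq_eq_false_iff_ne]; intro h
            apply hq; cases q; simp only [Prod.mk.injEq, List.cons.injEq, true_and] at h
            exact Prod.ext h.1 h.2
          have h2 : (q == (u, u₁')) = false := beq_eq_false_iff_ne.mpr hq
          rw [h1, h2]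
      · rw [if_neg hbx, if_neg hbx]
        have hne : ((q.1, x :: q.2) == (u, b :: u₁')) = false := by
          rw [beq_eq_false_iff_ne]; intro h
          simp only [Prod.mk.injEq, List.cons.injEq] at h
          exact hbx h.2.1.symm
        simp [hne]

/-- **Transposition of deshuffle and shuffle**: the pair `(u, u')` occurs among the deshuffles
of `w` exactly as many times as `w` occurs among the shuffles `u ш u'` — the coproduct
`Δ(x) = x ⊗ 1 + 1 ⊗ x` is the transpose of the shuffle product (Racinet 2002, §2, after Prop. 2.8;
Reutenauer 1993, §1.4). [cite: Racinet2002, §2] -/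
theorem count_deshuffle : ∀ (w u u' : List α),
    (deshuffle w).count (u, u') = (MZV.shuffleWord u u').count w
  | [], u, u' => by
    rw [deshuffle_nil, List.count_singleton]
    cases u with
    | nil =>
      rw [MZV.shuffleWord_nil_left, List.count_singleton]
      cases u' with
      | nil => simp
      | cons b u₁' =>
        have h1 : ((([] : List α), ([] : List α)) == ([], b :: u₁')) = false := by
          rw [beq_eq_false_iff_ne]; simp
        have h2 : ((b :: u₁') == ([] : List α)) = false := by
          rw [beq_eq_false_iff_ne]; simp
        rw [h1, h2]
    | cons a u₁ =>
      have h1 : ((([] : List α), ([] : List α)) == (a :: u₁, u')) = false := by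
        rw [beq_eq_false_iff_ne]; simp
      rw [h1]
      cases u' with
      | nil =>
        rw [MZV.shuffleWord_nil_right, List.count_singleton]
        have h2 : ((a :: u₁) == ([] : List α)) = false := by
          rw [beq_eq_false_iff_ne]; simp
        rw [h2]
      | cons b u₁' =>
        rw [MZV.shuffleWord_cons_cons, List.count_append, count_nil_map_cons, count_nil_map_cons]
        rfl
  | x :: w, u, u' => by
    rw [deshuffle_cons, List.count_append, count_map_consFst, count_map_consSnd]
    cases u with
    | nil =>
      cases u' with
      | nil =>
        rw [MZV.shuffleWord_nil_left, List.count_singleton]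
        have h2 : (([] : List α) == x :: w) = false := by rw [beq_eq_false_iff_ne]; simp
        rw [h2]; rfl
      | cons b u₁' =>
        dsimp only
        rw [MZV.shuffleWord_nil_left, List.count_singleton, zero_add]
        by_cases hbx : b = x
        · subst hbx
          rw [if_pos rfl, count_deshuffle w [] u₁', MZV.shuffleWord_nil_left, List.count_singleton]
          by_cases hw : u₁' = w
          · subst hw; simp
          · have h1 : (u₁' == w) = false := beq_eq_false_iff_ne.mpr hw
            have h2 : ((b :: u₁') == (b :: w)) = false := by
              rw [beq_eq_false_iff_ne]; simpa using hw
            rw [h1, h2]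
        · rw [if_neg hbx]
          have h2 : ((b :: u₁') == (x :: w)) = false := by
            rw [beq_eq_false_iff_ne]; intro h; exact hbx (List.cons.inj h).1
          rw [h2]; rfl
    | cons a u₁ =>
      cases u' with
      | nil =>
        dsimp only
        rw [MZV.shuffleWord_nil_right, List.count_singleton, add_zero]
        by_cases hax : a = x
        · subst hax
          rw [if_pos rfl, count_deshuffle w u₁ [], MZV.shuffleWord_nil_right, List.count_singleton]
          by_cases hw : u₁ = w
          · subst hw; simp
          · have h1 : (u₁ == w) = false := beq_eq_false_iff_ne.mpr hw
            have h2 : ((a :: u₁) == (a :: w)) = false := by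
              rw [beq_eq_false_iff_ne]; simpa using hw
            rw [h1, h2]
        · rw [if_neg hax]
          have h2 : ((a :: u₁) == (x :: w)) = false := by
            rw [beq_eq_false_iff_ne]; intro h; exact hax (List.cons.inj h).1
          rw [h2]; rfl
      | cons b u₁' =>
        dsimp only
        rw [MZV.shuffleWord_cons_cons, List.count_append, count_cons_map_cons, count_cons_map_cons]
        by_cases hax : a = x
        · subst hax
          rw [if_pos rfl, if_pos rfl, count_deshuffle w u₁ (b :: u₁')]
          by_cases hba : b = a
          · subst hba
            rw [if_pos rfl, if_pos rfl, count_deshuffle w (b :: u₁) u₁']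
          · rw [if_neg hba, if_neg (Ne.symm hba)]
        · rw [if_neg hax, if_neg (Ne.symm hax), zero_add, zero_add]
          by_cases hbx : b = x
          · subst hbx
            rw [if_pos rfl, if_pos rfl, count_deshuffle w (a :: u₁) u₁']
          · rw [if_neg hbx, if_neg (Ne.symm hbx)]

/-- `count_deshuffle` for a pair variable. [folklore] -/
theorem count_deshuffle_pair (w : List α) (p : List α × List α) :
    (deshuffle w).count p = (MZV.shuffleWord p.1 p.2).count w := by
  cases p; exact count_deshuffle w _ _

/-- A list sum as a finite sum weighted by multiplicities (stated for the `BEq` instance of the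
list operations, to be usable with `count_deshuffle`). [folklore] -/
theorem list_sum_map_eq_sum_count {β M : Type*} [BEq β] [LawfulBEq β] [DecidableEq β]
    [AddCommMonoid M] (L : List β) (P : Finset β) (hP : ∀ x ∈ L, x ∈ P) (f : β → M) :
    (L.map f).sum = ∑ p ∈ P, L.count p • f p := by
  induction L with
  | nil => simp
  | cons x L ih =>
    rw [List.map_cons, List.sum_cons, ih (fun y hy => hP y (List.mem_cons_of_mem _ hy))]
    have hx : x ∈ P := hP x List.mem_cons_self
    simp only [List.count_cons, add_smul, Finset.sum_add_distrib]
    rw [add_comm]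
    congr 1
    rw [Finset.sum_eq_single_of_mem x hx (fun p _ hpx => by
      have : (x == p) = false := beq_eq_false_iff_ne.mpr (Ne.symm hpx)
      simp [this])]
    simp

/-- **The transposition formula**: pairing a series against deshuffles equals pairing its shuffle
sums against pairs — `Σ_{|w| ≤ N} c_w(φ) Σ_{(u,u') ∈ deshuffle w} f(u,u')
= Σ_{|u|+|u'| ≤ N} (Σ_{w ∈ u ш u'} c_w(φ)) f(u,u')`, i.e. `⟨φ, Δᵗ(f)⟩ = ⟨ш^t φ, f⟩`.
[cite: Racinet2002, §2] -/
theorem sum_smul_deshuffle_eq [Fintype α] [Semiring R] {M : Type*} [AddCommMonoid M] [Module R M]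
    (φ : NCSeries α R) (N : ℕ) (f : List α × List α → M) :
    ∑ w ∈ wordsLE α N, φ w • ((deshuffle w).map f).sum =
      ∑ u ∈ wordsLE α N, ∑ u' ∈ wordsLE α N,
        if u.length + u'.length ≤ N then ((MZV.shuffleWord u u').map φ).sum • f (u, u') else 0 := by
  set P := wordsLE α N ×ˢ wordsLE α N with hP
  calc ∑ w ∈ wordsLE α N, φ w • ((deshuffle w).map f).sum
      = ∑ w ∈ wordsLE α N, ∑ p ∈ P, ((deshuffle w).count p • φ w) • f p := by
        refine Finset.sum_congr rfl fun w hw => ?_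
        rw [list_sum_map_eq_sum_count (deshuffle w) P (fun p hp => ?_) f, Finset.smul_sum]
        · refine Finset.sum_congr rfl fun p _ => ?_
          rw [smul_assoc]
          exact smul_comm _ _ _
        · have hl := length_add_length_of_mem_deshuffle w hp
          rw [mem_wordsLE] at hw
          rw [hP, Finset.mem_product, mem_wordsLE, mem_wordsLE]
          omega
    _ = ∑ p ∈ P, (∑ w ∈ wordsLE α N, (deshuffle w).count p • φ w) • f p := by
        rw [Finset.sum_comm]
        simp only [Finset.sum_smul]
    _ = ∑ p ∈ P, (if p.1.length + p.2.length ≤ N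
          then ((MZV.shuffleWord p.1 p.2).map φ).sum else 0) • f p := by
        refine Finset.sum_congr rfl fun p _ => ?_
        congr 1
        simp_rw [count_deshuffle_pair]
        split_ifs with h
        · rw [list_sum_map_eq_sum_count (MZV.shuffleWord p.1 p.2) (wordsLE α N) (fun w hw => ?_) φ]
          rw [mem_wordsLE, MZV.length_of_mem_shuffleWord _ _ hw]
          exact h
        · refine Finset.sum_eq_zero fun w hw => ?_
          rw [List.count_eq_zero.mpr (fun hmem => ?_), zero_smul]
          rw [mem_wordsLE] at hw
          have := MZV.length_of_mem_shuffleWord _ _ hmem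
          omega
    _ = _ := by
        rw [hP, Finset.sum_product]
        refine Finset.sum_congr rfl fun u _ => Finset.sum_congr rfl fun u' _ => ?_
        split_ifs <;> simp

/-- **Transposition for group-like series**: `Σ_{|w| ≤ N} c_w(φ) Σ_{deshuffle w} f
= Σ_{|u|+|u'| ≤ N} c_u(φ) c_{u'}(φ) f(u,u')` (`Δ φ = φ ⊗ φ`). [folklore] -/
theorem IsGroupLike.sum_smul_deshuffle_eq [Fintype α] [Semiring R] {M : Type*} [AddCommMonoid M]
    [Module R M] {φ : NCSeries α R} (hg : IsGroupLike φ) (N : ℕ) (f : List α × List α → M) :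
    ∑ w ∈ wordsLE α N, φ w • ((deshuffle w).map f).sum =
      ∑ u ∈ wordsLE α N, ∑ u' ∈ wordsLE α N,
        if u.length + u'.length ≤ N then (φ u * φ u') • f (u, u') else 0 := by
  rw [NCSeries.sum_smul_deshuffle_eq φ N f]
  simp only [← hg.mul_eq_sum_shuffleWord]

end Deshuffle

/-! ## 3. The word binomial formula and central shifts -/

section Binomial

variable {A : Type*} [Semiring A]

/-- An element commuting with `a` and `b` commutes with every word in `a, b`. [folklore] -/
theorem commute_prod_map_bsub {e a b : A} (ha : Commute e a) (hb : Commute e b) :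
    ∀ u : List Bool, Commute e ((u.map (bsub a b)).prod)
  | [] => by simp
  | c :: u => by
    rw [List.map_cons, List.prod_cons]
    refine Commute.mul_right ?_ (commute_prod_map_bsub ha hb u)
    cases c
    · exact ha
    · exact hb

/-- **Word binomial formula**: substituting sums of commuting pairs into a word,
`w(a + c, b + d) = Σ_{(u,u') ∈ deshuffle w} u(a, b) · u'(c, d)` when `c, d` commute with `a, b`
(the letters of `w` sent to `(c, d)` form the subword `u'`). [folklore] -/
theorem prod_map_bsub_add {a b c d : A} (hca : Commute c a) (hcb : Commute c b)
    (hda : Commute d a) (hdb : Commute d b) : ∀ w : List Bool,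
    (w.map (bsub (a + c) (b + d))).prod =
      ((deshuffle w).map fun p => (p.1.map (bsub a b)).prod * (p.2.map (bsub c d)).prod).sum
  | [] => by simp
  | x :: w => by
    rw [List.map_cons, List.prod_cons, prod_map_bsub_add hca hcb hda hdb w, deshuffle_cons,
      List.map_append, List.sum_append, List.map_map, List.map_map]
    have hx : bsub (a + c) (b + d) x = bsub a b x + bsub c d x := by cases x <;> rfl
    rw [hx, add_mul, ← List.sum_map_mul_left, ← List.sum_map_mul_left]
    congr 1
    · refine congrArg List.sum (List.map_congr_left fun p _ => ?_)
      simp only [Function.comp_apply, List.map_cons, List.prod_cons, mul_assoc]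
    · refine congrArg List.sum (List.map_congr_left fun p _ => ?_)
      simp only [Function.comp_apply, List.map_cons, List.prod_cons]
      have hc : Commute (bsub c d x) ((p.1.map (bsub a b)).prod) := by
        cases x
        · exact commute_prod_map_bsub hca hcb p.1
        · exact commute_prod_map_bsub hda hdb p.1
      rw [← mul_assoc, hc.eq, mul_assoc]

end Binomial

section CentralShift

variable {R : Type v} [CommRing R] [Algebra ℚ R] {A : Type*} [Ring A] [Algebra R A]

/-- A word containing the letter `1` vanishes under `(X₀, X₁) ↦ (c, 0)`. [folklore] -/
theorem prod_map_bsub_zero_right_eq_zero (c : A) {u : List Bool} (hu : true ∈ u) :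
    (u.map (bsub c 0)).prod = 0 :=
  List.prod_eq_zero (List.mem_map.mpr ⟨true, hu, rfl⟩)

/-- A word containing the letter `0` vanishes under `(X₀, X₁) ↦ (0, d)`. [folklore] -/
theorem prod_map_bsub_zero_left_eq_zero (d : A) {u : List Bool} (hu : false ∈ u) :
    (u.map (bsub 0 d)).prod = 0 :=
  List.prod_eq_zero (List.mem_map.mpr ⟨false, hu, rfl⟩)

/-- **Central-shift invariance, first slot** [Furusho2010, proof of Lemma 5, "N.B."]: for a
group-like `φ` with `c_{X}(φ) = 0` (over a `ℚ`-algebra) and `C` commuting with `A` and `B`,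
`φ(A + C, B) = φ(A, B)` in every weight truncation. Proof: word binomial formula + transposition
+ `c_{Xˢ}(φ) = 0` for `s ≥ 1`. [cite: Furusho2010, Lemma 5] -/
theorem IsGroupLike.evalTrunc_bsub_add_left {φ : NCSeries Bool R} (hg : IsGroupLike φ)
    (h0 : φ [false] = 0) (N : ℕ) {a b c : A} (hca : Commute c a) (hcb : Commute c b) :
    evalTrunc N (bsub (a + c) b) φ = evalTrunc N (bsub a b) φ := by
  rw [evalTrunc_eq_sum_wordsLE, evalTrunc_eq_sum_wordsLE]
  have hexp : ∀ w : List Bool, (w.map (bsub (a + c) b)).prod =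
      ((deshuffle w).map fun p => (p.1.map (bsub a b)).prod * (p.2.map (bsub c 0)).prod).sum := by
    intro w
    have h := prod_map_bsub_add hca hcb (Commute.zero_left a) (Commute.zero_left b) w
    rwa [add_zero] at h
  simp_rw [hexp]
  rw [hg.sum_smul_deshuffle_eq N]
  refine Finset.sum_congr rfl fun u hu => ?_
  rw [mem_wordsLE] at hu
  rw [Finset.sum_eq_single_of_mem [] (by simp) ?_]
  · simp [hu, hg.1]
  · intro u' _ hne
    split_ifs with h
    · by_cases ht : true ∈ u'
      · rw [prod_map_bsub_zero_right_eq_zero c ht, mul_zero, smul_zero]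
      · have hu' : u' = List.replicate u'.length false :=
          List.eq_replicate_iff.mpr ⟨rfl, fun x hx => by
            cases x
            · rfl
            · exact absurd hx ht⟩
        rw [hu', hg.apply_replicate_eq_zero h0 _ (fun h' => hne (List.length_eq_zero_iff.mp h')),
          mul_zero, zero_smul]
    · rfl

/-- **Central-shift invariance, second slot**: `φ(A, B + C) = φ(A, B)` for group-like `φ` with
`c_Y(φ) = 0` and `C` commuting with `A`, `B`. [cite: Furusho2010, Lemma 5] -/
theorem IsGroupLike.evalTrunc_bsub_add_right {φ : NCSeries Bool R} (hg : IsGroupLike φ)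
    (h1 : φ [true] = 0) (N : ℕ) {a b c : A} (hca : Commute c a) (hcb : Commute c b) :
    evalTrunc N (bsub a (b + c)) φ = evalTrunc N (bsub a b) φ := by
  rw [evalTrunc_eq_sum_wordsLE, evalTrunc_eq_sum_wordsLE]
  have hexp : ∀ w : List Bool, (w.map (bsub a (b + c))).prod =
      ((deshuffle w).map fun p => (p.1.map (bsub a b)).prod * (p.2.map (bsub 0 c)).prod).sum := by
    intro w
    have h := prod_map_bsub_add (Commute.zero_left a) (Commute.zero_left b) hca hcb w
    rwa [add_zero] at h
  simp_rw [hexp]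
  rw [hg.sum_smul_deshuffle_eq N]
  refine Finset.sum_congr rfl fun u hu => ?_
  rw [mem_wordsLE] at hu
  rw [Finset.sum_eq_single_of_mem [] (by simp) ?_]
  · simp [hu, hg.1]
  · intro u' _ hne
    split_ifs with h
    · by_cases hf : false ∈ u'
      · rw [prod_map_bsub_zero_left_eq_zero c hf, mul_zero, smul_zero]
      · have hu' : u' = List.replicate u'.length true :=
          List.eq_replicate_iff.mpr ⟨rfl, fun x hx => by
            cases x
            · exact absurd hx hf
            · rfl⟩
        rw [hu', hg.apply_replicate_eq_zero h1 _ (fun h' => hne (List.length_eq_zero_iff.mp h')),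
          mul_zero, zero_smul]
    · rfl

end CentralShift

end NCSeries

end Literature.NumberTheory.Transcendental
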